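import Literature.NumberTheory.Sieve.LargestPrimeFactorCubicMertensG
import Literature.NumberTheory.Sieve.LargestPrimeFactorCubicWindowBridge
import Literature.NumberTheory.Sieve.LargestPrimeFactorCubicNuRoot
import Literature.NumberTheory.Sieve.LargestPrimeFactorCubicVolumeGeneral
import Literature.NumberTheory.Sieve.LargestPrimeFactorCubicKProduct
import Literature.NumberTheory.Sieve.LargestPrimeFactorCubicEulerIdentity
import HarnessLib

/-!
# Heath-Brown 2001 (PLMS), Lemmas 8–9 and §8: the limits entering `S₀ ≥ {C₂C₃L(δ) + o(1)}` and the
# numerical lower bound of the limit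

Topic `Literature/NumberTheory/Sieve`; a PROVED analytic/numeric layer (two definitions with bodies, no named
facts) under the named fact `Irving2015_largestPrimeFactor_cubic` (`LargestPrimeFactorCubic.lean`): the limits
of the factors of the main term of `…S0Main.S0sumG_regionGens_ge` and the value of the limit.  Source: D. R.
Heath-Brown, *The largest prime factor of `X³ + 2`*, Proc. London Math. Soc. (3) 82 (2001) 554–596: Lemma 8
(`S₀ ≥ {C₂ + o(1)}δL(δ)(log X)∏_{p<X^δ}(1 − g(p)/p)`, `L(δ) = log(1 + 7δ/5)log(1 + 7δ/6)`), Lemma 9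
(`∏_{p<X^δ}(1 − g(p)/p) ∼ C₃/log X^δ`), §8 p. 31 (`∑ ν(q₁)ν(q₂)/(q₁q₂) = L(δ) + o(1)`), (8.14)
(`I₁ = 3^{−3/2}(π/2 − 3η) δ(log X)(log ε₀) + O(1)`), p. 12 (`S₀ ≥ 9.2 × 10^{−8}` for `δ = 1/321`).

* `tendsto_gProd_pow_mul_log` — `gProd(X^δ)·log(X^δ) → C₃` along `X → ∞` in `ℕ`;
* `LXfun X = (∑_{q1Range} ν(q)/q)(∑_{q2Range} ν(q)/q)`, `LXfun_eq`, `LXfun_nonneg`, `tendsto_LXfun` (`→ L(δ)`);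
* `Ishr_eq`, `tendsto_Ishr_div_log` (`I(𝓢_η)/log X^δ → π log E/(12√3)` for `η_X → 0`), `Iup_eq`;
* `mainLim`, `mainLim_eq` (`= (1 − ε₁/C₀)·log2·log(4/3)/(3π²)·P·L(δ)`, via `C2C3_shape`), **`mainLim_gt`**
  (`> 9.2·10⁻⁸ + 5·10⁻¹⁰` for `ε₁ = C₀/10⁴`, `P ≥ 0.917`).

## References

* D. R. Heath-Brown, *The largest prime factor of `X³ + 2`*, Proc. London Math. Soc. (3) 82 (2001)
  554–596, Lemmas 8–9 pp. 11–12, §8 pp. 31–34. [`HeathBrown2001LargestPrimeFactorCubic`]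

## Mathlib / tree search

Tree: `gProd`, `C3`, `C3_eq`, `tendsto_gProd_mul_log`, `Rinf`, `Rinf_pos` (`…MertensG`), `tendsto_L_ranges`,
`q1Range_eq_window` (`…WindowBridge`), `nuRoot`, `nuRoot_prime`, `nuP` (`…NuRoot`/`…EulerIdentity`),
`genVolume_eq` (`…VolumeGeneral`), `S0_numeric`, `log_four_thirds_ge` (`…KProduct`), `C2C3_shape`
(`…EulerIdentity`), `unitE`, `one_lt_unitE`, `log_unitE_pos`, `hbδ`, `hbδ_pos`, `Npar`.
Mathlib: `tendsto_rpow_atTop`, `Real.tendsto_log_atTop`, `Filter.Tendsto.mul/div/add/comp`.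
-/

noncomputable section

open Finset Real Filter Topology

namespace Literature.NumberTheory.Sieve.HeathBrown2001

open LargestPrimeFactorCubic CubicSieve CubicPrimes

/-! ### `∏_{p<X^δ}(1 − g(p)/p) · log X^δ → C₃` -/

/-- **Lemma 9 along `X^δ`**: `gProd(X^δ)·log(X^δ) → C₃`. [cite: HeathBrown2001LargestPrimeFactorCubic, Lemma 9] -/
theorem tendsto_gProd_pow_mul_log :
    Tendsto (fun X : ℕ => gProd ((X : ℝ) ^ hbδ) * Real.log ((X : ℝ) ^ hbδ)) atTop (𝓝 C3) := by
  have h := tendsto_gProd_mul_log.comp ((tendsto_rpow_atTop hbδ_pos).comp tendsto_natCast_atTop_atTop)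
  exact h

/-! ### `L_X → L(δ)` -/

/-- `L_X = (∑_{q ∈ q1Range} ν(q)/q)(∑_{q ∈ q2Range} ν(q)/q)`. [cite: HeathBrown2001LargestPrimeFactorCubic, §8 p. 31] -/
def LXfun (X : ℕ) : ℝ := (∑ q ∈ q1Range X, nuRoot q / q) * (∑ q ∈ q2Range X, nuRoot q / q)

/-- `ν(q)/q = g(q)/(q+1)` at primes, so `L_X` is the product of the two `g/(q+1)` window sums. [folklore] -/
theorem LXfun_eq (X : ℕ) : LXfun X =
    (∑ q ∈ q1Range X, (cubeRootTwoCount q : ℝ) / (q + 1)) * (∑ q ∈ q2Range X, (cubeRootTwoCount q : ℝ) / (q + 1)) := by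
  have h : ∀ q : ℕ, q.Prime → nuRoot q / q = (cubeRootTwoCount q : ℝ) / (q + 1) := by
    intro q hq
    rw [nuRoot_prime hq, nuP]
    have hq0 : (q : ℝ) ≠ 0 := by exact_mod_cast hq.ne_zero
    field_simp
  rw [LXfun]
  congr 1
  · refine sum_congr rfl fun q hq => h q ?_
    rw [q1Range, mem_filter] at hq; exact hq.2
  · refine sum_congr rfl fun q hq => h q ?_
    rw [q2Range, mem_filter] at hq; exact hq.2

/-- `L_X ≥ 0`. [folklore] -/
theorem LXfun_nonneg (X : ℕ) : 0 ≤ LXfun X := by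
  unfold LXfun
  exact mul_nonneg (sum_nonneg fun q _ => div_nonneg (nuRoot_nonneg q) (Nat.cast_nonneg q))
    (sum_nonneg fun q _ => div_nonneg (nuRoot_nonneg q) (Nat.cast_nonneg q))

/-- **`L_X → L(δ)`**. [cite: HeathBrown2001LargestPrimeFactorCubic, §8 p. 31, Lemma 8] -/
theorem tendsto_LXfun : Tendsto LXfun atTop (𝓝 (Real.log (1 + 7 * hbδ / 5) * Real.log (1 + 7 * hbδ / 6))) := by
  refine tendsto_L_ranges.congr fun X => ?_
  rw [LXfun_eq]

/-! ### The volume integrals -/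

/-- **`I(𝓢_η)`** evaluated: for `0 ≤ η ≤ 1/4`, `(1+η) ≤ E(1−η)` and `(1+η)N₁ ≤ (1−η)N₂`,
`I(𝓢_η) = (π − 2η)·log((1−η)N₂/((1+η)N₁))·log(E(1−η)/(1+η))/(6√3)`. [cite: HeathBrown2001LargestPrimeFactorCubic, §8 (8.14)] -/
theorem Ishr_eq {N₁ N₂ η : ℝ} (hN₁ : 0 < N₁) (hη : 0 ≤ η) (hη4 : η ≤ 1 / 4) (hηE : 1 + η ≤ unitE * (1 - η))
    (hN : N₁ * (1 + η) ≤ N₂ * (1 - η)) :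
    genVolume (2 * (1 + η)) (2 * unitE * (1 - η)) (-(2 * Real.pi / 3) + η) (Real.pi / 3 - η) (N₁ * (1 + η)) (N₂ * (1 - η)) =
      (Real.pi - 2 * η) * Real.log (N₂ * (1 - η) / (N₁ * (1 + η))) * Real.log (unitE * (1 - η) / (1 + η)) / (6 * Real.sqrt 3) := by
  have hπ := Real.pi_gt_three
  rw [genVolume_eq (by positivity) hN (by positivity) (by linarith) (by linarith) (by linarith) (by linarith)]
  have h1 : Real.pi / 3 - η - (-(2 * Real.pi / 3) + η) = Real.pi - 2 * η := by ring
  have h2 : 2 * unitE * (1 - η) / (2 * (1 + η)) = unitE * (1 - η) / (1 + η) := by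
    field_simp
  rw [h1, h2]

/-- **`I(box) = 2π·log(N₂/N₁)·log E/(6√3)`** (`0 < N₁ ≤ N₂`). [cite: HeathBrown2001LargestPrimeFactorCubic, §8 (I(𝓡₀))] -/
theorem Iup_eq {N₁ N₂ : ℝ} (hN₁ : 0 < N₁) (hN : N₁ ≤ N₂) :
    genVolume 2 (2 * unitE) (-Real.pi) Real.pi N₁ N₂ = 2 * Real.pi * Real.log (N₂ / N₁) * Real.log unitE / (6 * Real.sqrt 3) := by
  have hE := one_lt_unitE
  rw [genVolume_eq hN₁ hN (by norm_num) (by linarith) le_rfl (by linarith [Real.pi_pos]) le_rfl]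
  have h2 : (2 * unitE) / 2 = unitE := by field_simp
  rw [h2]; ring

/-- **`I(𝓢_{η_X})/log X^δ → π log E/(12√3)`** for `η_X → 0`, `N₁ = X^{1+3δ/2}`, `N₂ = X^{1+2δ}` (so that
`log(N₂/N₁) = (1/2) log X^δ`). [cite: HeathBrown2001LargestPrimeFactorCubic, §8 (8.14)] -/
theorem tendsto_Ishr_div_log {η : ℕ → ℝ} (hη0 : ∀ X, 0 ≤ η X) (hη : Tendsto η atTop (𝓝 0)) :
    Tendsto (fun X : ℕ =>
      ((Real.pi - 2 * η X) * Real.log ((X : ℝ) ^ (1 + 2 * hbδ) * (1 - η X) / ((X : ℝ) ^ (1 + 3 * hbδ / 2) * (1 + η X))) *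
          Real.log (unitE * (1 - η X) / (1 + η X)) / (6 * Real.sqrt 3)) / Real.log ((X : ℝ) ^ hbδ))
      atTop (𝓝 (Real.pi * Real.log unitE / (12 * Real.sqrt 3))) := by
  have hδ := hbδ_pos
  have hE := one_lt_unitE
  -- `log(N₂(1−η)/(N₁(1+η))) / log X^δ = 1/2 + log((1−η)/(1+η))/log X^δ → 1/2`
  have hlog : Tendsto (fun X : ℕ => Real.log ((X : ℝ) ^ hbδ)) atTop atTop :=
    Real.tendsto_log_atTop.comp ((tendsto_rpow_atTop hδ).comp tendsto_natCast_atTop_atTop)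
  have hratio : Tendsto (fun X : ℕ => Real.log ((1 - η X) / (1 + η X))) atTop (𝓝 0) := by
    have h1 : Tendsto (fun X : ℕ => (1 - η X) / (1 + η X)) atTop (𝓝 1) := by
      have := ((tendsto_const_nhds (x := (1 : ℝ))).sub hη).div ((tendsto_const_nhds (x := (1 : ℝ))).add hη) (by norm_num)
      rw [sub_zero, add_zero, div_one] at this
      exact this
    have := (Real.continuousAt_log one_ne_zero).tendsto.comp h1
    rw [Real.log_one] at this
    exact this
  have hA : Tendsto (fun X : ℕ => Real.log ((X : ℝ) ^ (1 + 2 * hbδ) * (1 - η X) / ((X : ℝ) ^ (1 + 3 * hbδ / 2) * (1 + η X))) /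
      Real.log ((X : ℝ) ^ hbδ)) atTop (𝓝 (1 / 2)) := by
    have hev : ∀ᶠ X : ℕ in atTop, Real.log ((X : ℝ) ^ (1 + 2 * hbδ) * (1 - η X) / ((X : ℝ) ^ (1 + 3 * hbδ / 2) * (1 + η X))) /
        Real.log ((X : ℝ) ^ hbδ) = 1 / 2 + Real.log ((1 - η X) / (1 + η X)) / Real.log ((X : ℝ) ^ hbδ) := by
      filter_upwards [eventually_gt_atTop 1, (hη.eventually (Iio_mem_nhds (show (0:ℝ) < 1 by norm_num)))] with X hX hlt1
      have hX0 : (0 : ℝ) < X := by exact_mod_cast (zero_lt_one.trans hX)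
      have hX1 : (1 : ℝ) < X := by exact_mod_cast hX
      have hηX := hη0 X
      have hlt : η X < 1 := hlt1
      have h1m : 0 < 1 - η X := by linarith
      have h1p : 0 < 1 + η X := by linarith
      have hlogX : Real.log ((X : ℝ) ^ hbδ) ≠ 0 := by
        rw [Real.log_rpow hX0]; exact mul_ne_zero hδ.ne' (Real.log_pos hX1).ne'
      have e1 : (X : ℝ) ^ (1 + 2 * hbδ) * (1 - η X) / ((X : ℝ) ^ (1 + 3 * hbδ / 2) * (1 + η X)) =
          (X : ℝ) ^ (hbδ / 2) * ((1 - η X) / (1 + η X)) := by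
        rw [show (1 + 2 * hbδ : ℝ) = (1 + 3 * hbδ / 2) + hbδ / 2 by ring, Real.rpow_add hX0]
        field_simp
      rw [e1, Real.log_mul (Real.rpow_pos_of_pos hX0 _).ne' (div_pos h1m h1p).ne', Real.log_rpow hX0, Real.log_rpow hX0,
        add_div]
      congr 1
      field_simp [(Real.log_pos hX1).ne']
    refine Tendsto.congr' (hev.mono fun X h => h.symm) ?_
    have := (tendsto_const_nhds (x := (1 / 2 : ℝ))).add (hratio.div_atTop hlog)
    rw [add_zero] at this
    exact this
  have hB : Tendsto (fun X : ℕ => Real.pi - 2 * η X) atTop (𝓝 Real.pi) := by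
    have := (tendsto_const_nhds (x := Real.pi)).sub (hη.const_mul 2)
    rw [mul_zero, sub_zero] at this
    exact this
  have hC : Tendsto (fun X : ℕ => Real.log (unitE * (1 - η X) / (1 + η X))) atTop (𝓝 (Real.log unitE)) := by
    have h1 : Tendsto (fun X : ℕ => unitE * (1 - η X) / (1 + η X)) atTop (𝓝 unitE) := by
      have := (((tendsto_const_nhds (x := unitE)).mul ((tendsto_const_nhds (x := (1 : ℝ))).sub hη)).div
        ((tendsto_const_nhds (x := (1 : ℝ))).add hη) (by norm_num))
      rw [sub_zero, mul_one, add_zero, div_one] at this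
      exact this
    exact (Real.continuousAt_log (by linarith)).tendsto.comp h1
  have hall := (hB.mul hA).mul hC
  have hlim : Real.pi * (1 / 2) * Real.log unitE / (6 * Real.sqrt 3) = Real.pi * Real.log unitE / (12 * Real.sqrt 3) := by ring
  rw [← hlim]
  refine ((hall.div_const (6 * Real.sqrt 3))).congr fun X => ?_
  ring

/-! ### The value of the limit -/

/-- The limit of the main term, as a function of `ε₁` and `P`:
`(log 4/3)(C₀ − ε₁)·2·C₃·C₁·(1/3)·(π log E/(12√3))·L(δ)`, `C₁ = (6/π²)(P/(2R_∞))`, `C₀ = (2/3)e^γ log 2`.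
[cite: HeathBrown2001LargestPrimeFactorCubic, Lemmas 8–9, p. 12] -/
def mainLim (ε₁ P : ℝ) : ℝ :=
  Real.log (4 / 3) * (2 / 3 * Real.exp Real.eulerMascheroniConstant * Real.log 2 - ε₁) * 2 * C3 *
    (6 / Real.pi ^ 2 * (P / (2 * Rinf))) * (1 / 3) * (Real.pi * Real.log unitE / (12 * Real.sqrt 3)) *
    (Real.log (1 + 7 * hbδ / 5) * Real.log (1 + 7 * hbδ / 6))

/-- **`mainLim ε₁ P = (1 − ε₁/C₀)·log2·log(4/3)/(3π²)·P·L(δ)`** (the constants `C₂C₃` of Lemmas 8–9, `log E` cancelling).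
[cite: HeathBrown2001LargestPrimeFactorCubic, Lemmas 8–9 (C₂, C₃)] -/
theorem mainLim_eq (ε₁ P : ℝ) : mainLim ε₁ P =
    (1 - ε₁ / (2 / 3 * Real.exp Real.eulerMascheroniConstant * Real.log 2)) *
      (Real.log 2 * Real.log (4 / 3) / (3 * Real.pi ^ 2) * P * (Real.log (1 + 7 * hbδ / 5) * Real.log (1 + 7 * hbδ / 6))) := by
  rw [mainLim, C3_eq, sqrt_twentySeven]
  have hπ : Real.pi ≠ 0 := Real.pi_pos.ne'
  have h3 : Real.sqrt 3 ≠ 0 := (Real.sqrt_pos.mpr (by norm_num)).ne'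
  have hexp : Real.exp Real.eulerMascheroniConstant ≠ 0 := (Real.exp_pos _).ne'
  have hlogE : Real.log unitE ≠ 0 := log_unitE_pos.ne'
  have hR : Rinf ≠ 0 := Rinf_pos.ne'
  have hlog2 : Real.log 2 ≠ 0 := (Real.log_pos (by norm_num)).ne'
  field_simp
  ring

/-- **The limit exceeds Irving's threshold**: `9.2·10⁻⁸ + 5·10⁻¹⁰ < mainLim (C₀/10⁴) P` for `P ≥ 0.917`.
[cite: HeathBrown2001LargestPrimeFactorCubic, p. 12 ("S₀ ≥ 9.2 × 10⁻⁸")] -/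
theorem mainLim_gt {P : ℝ} (hP : (917 / 1000 : ℝ) ≤ P) :
    (9.2 / 10 ^ 8 + 5 / 10 ^ 10 : ℝ) < mainLim ((2 / 3 * Real.exp Real.eulerMascheroniConstant * Real.log 2) / 10 ^ 4) P := by
  rw [mainLim_eq]
  have hC0 : 0 < 2 / 3 * Real.exp Real.eulerMascheroniConstant * Real.log 2 := by
    have := Real.log_pos (by norm_num : (1 : ℝ) < 2); positivity
  have h1 : 1 - 2 / 3 * Real.exp Real.eulerMascheroniConstant * Real.log 2 / 10 ^ 4 /
      (2 / 3 * Real.exp Real.eulerMascheroniConstant * Real.log 2) = 1 - 1 / 10 ^ 4 := by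
    field_simp
  rw [h1]
  -- `S0_numeric` at `P' = 0.91 · (P/0.917) ≥ 0.91`: we use it at `P` rescaled
  have hnum := S0_numeric (P := P * (91 / 100) / (917 / 1000)) (by
    rw [le_div_iff₀ (by norm_num)]; nlinarith)
  -- `A·P = (A·(P·0.91/0.917))·(0.917/0.91)`
  have hkey : Real.log 2 * Real.log (4 / 3) / (3 * Real.pi ^ 2) * P * (Real.log (1 + 7 * (1 / 321) / 5) * Real.log (1 + 7 * (1 / 321) / 6)) =
      (Real.log 2 * Real.log (4 / 3) / (3 * Real.pi ^ 2) * (P * (91 / 100) / (917 / 1000)) *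
        (Real.log (1 + 7 * (1 / 321) / 5) * Real.log (1 + 7 * (1 / 321) / 6))) * ((917 / 1000) / (91 / 100)) := by
    field_simp
  rw [hbδ, hkey]
  nlinarith [hnum]

end Literature.NumberTheory.Sieve.HeathBrown2001
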